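import Literature.AnabelianGeometry.EtaleTheta.BiKummerThm44SubNHSatDef22
import HarnessLib

/-!
# [EtTh] Thm 4.4 (iii), T44-L15b at the faithful [FrdII] Def 2.2 (ii) reading — UP TO INNER AUTOMORPHISM

Companion (proof-only) of `BiKummerThm44SubNHSatDef22.lean` (abc-iut-w6-d047, p437196/p438298): the reduction
`Thm44Hyp.preservesNHSaturatedBsFld_of_def22Iso` asks `Ψ` to induce an isomorphism of [FrdII] Def 2.2 contexts
`ctx₁ A'' ⥲ ctx₂ B''` ON THE NOSE, i.e. intertwining the two CHOSEN representatives `outer_i : G_{K_i} → Aut_E((A_i)_E)`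
of the outer homomorphisms of [FrdII] Def 2.2 (i).  Print only determines `G ↠ G_A` «up to composition with an inner
automorphism» (FrdII p.17), and [FrdI] Thm 3.4 (v) / [SemiAnbd] Prop 3.2 / [AbsAnab] Lem 1.3.8 only supply the
intertwining after re-choosing representatives.  This file records the honest input shape: an isomorphism
`(ctx₁ A'').conjOuter g₁ ⥲ (ctx₂ B'').conjOuter g₂` for SOME `g₁`, `g₂` suffices, by abc-iut-L1-d4's DISCHARGED
`PadicKummer.saturationConjugationInvariant_holds` ([FrdII] Def 2.2 (ii) «[conditions which are unaffected by composition
with conjugation by an element of G]»).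

References: [MochizukiEtTh2009] S. Mochizuki, The étale theta function…, Publ. RIMS 45 (2009), Thm 4.4 (iii) p.95;
[MochizukiFrdII2008] S. Mochizuki, The geometry of Frobenioids II, Kyushu J. Math. 62 (2008), Def 2.2 (i)/(ii) p.17,
Thm 2.4 (i) p.19.
-/

/-! ## The reduction UP TO INNER AUTOMORPHISM — [FrdII] Def 2.2 (i) «outer homomorphism»

[FrdII] Def 2.2 (i) (p.17) determines the homomorphism `G ↠ G_A ⊆ Aut_E(A_E)` only up to composition with an inner
automorphism; so what `Ψ` (together with the two CHOSEN representatives `outer₁`, `outer₂`) honestly induces is an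
isomorphism of Def 2.2 contexts `(ctx₁ A'').conjOuter g₁ ⥲ (ctx₂ B'').conjOuter g₂` for SOME `g₁ ∈ G_{K₁}`, `g₂ ∈ G_{K₂}`
(abc-iut-L1-d4's `Def22Context.conjOuter`).  abc-iut-L1-d4's DISCHARGED `PadicKummer.saturationConjugationInvariant_holds`
([FrdII] Def 2.2 (ii) «conditions which are unaffected by composition with conjugation by an element of `G`») removes the
two representatives: T44-L15b ⇐ context isomorphisms UP TO INNER AUTOMORPHISM (`hIsoConj`).  Proof-only.
-/

namespace Literature.AnabelianGeometry.EtaleTheta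

open CategoryTheory Opposite Literature.AlgebraicGeometry.Frobenioids Literature.AnabelianGeometry.SemiGraphs

namespace BiKummerSetting

universe u₀ v₀ u v w

section GeneralConj

variable {K : Type u₀} [Field K] {K' : Type u₀} [Field K'] {D₀ : Type u₀} [Category.{v₀} D₀]
  {V : FrdIMonoidStub.{w}}
  {X₁ : SemiGraphs.TemperedArithmeticGroup.{u₀} K} {X₂ : SemiGraphs.TemperedArithmeticGroup.{u₀} K'}
  {D₀' : Type u₀} [Category.{v₀} D₀']
  {T₁ : RealifiedDivisorMonoids (D₀ := D₀) V} {T₂ : RealifiedDivisorMonoids (D₀ := D₀') V}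
  {D₁ D₂ : Type u} [Category.{v} D₁] [Category.{v} D₂] {VD₁ : FrdICatStub.{u, v, w} D₁}
  {VD₂ : FrdICatStub.{u, v, w} D₂} {S₁ : BiKummerSetting X₁ T₁ D₁ VD₁} {S₂ : BiKummerSetting X₂ T₂ D₂ VD₂}

/-- **`(N, H^{bs-fld}_⊙)`-saturation transported along a context isomorphism UP TO INNER AUTOMORPHISM**: if the slots
read [FrdII] Def 2.2 (ii) through `ctx₁`, `ctx₂` (`hNH₁`, `hNH₂`), an isomorphism `(ctx₁ A'').conjOuter g₁ ⥲
(ctx₂ B'').conjOuter g₂` identifies the two saturation conditions — `Def22Context.Iso.isNHSaturated_iff` ([FrdII]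
Thm 2.4 (i)) between the conjugated contexts, and `saturationConjugationInvariant_holds` ([FrdII] Def 2.2 (ii),
«unaffected by conjugation») on both sides. [cite: MochizukiFrdII2008, Def 2.2 (ii) p.17] -/
theorem isNHSaturatedBsFld_iff_of_def22Iso_conjOuter
    (ctx₁ : S₁.C → PadicKummer.Def22Context) (ctx₂ : S₂.C → PadicKummer.Def22Context)
    (hNH₁ : ∀ (A : S₁.C) (N : ℕ+),
      S₁.IsNHSaturatedBsFld S₁.HodotBsFld A N ↔ PadicKummer.IsNHSaturated (ctx₁ A) N)
    (hNH₂ : ∀ (B : S₂.C) (N : ℕ+),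
      S₂.IsNHSaturatedBsFld S₂.HodotBsFld B N ↔ PadicKummer.IsNHSaturated (ctx₂ B) N)
    {A'' : S₁.C} {B'' : S₂.C} (g₁ : (ctx₁ A'').G) (g₂ : (ctx₂ B'').G)
    (ι : PadicKummer.Def22Context.Iso ((ctx₁ A'').conjOuter g₁) ((ctx₂ B'').conjOuter g₂)) (N : ℕ+) :
    S₁.IsNHSaturatedBsFld S₁.HodotBsFld A'' N ↔ S₂.IsNHSaturatedBsFld S₂.HodotBsFld B'' N := by
  rw [hNH₁, hNH₂, PadicKummer.saturationConjugationInvariant_holds (ctx₁ A'') N g₁,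
    PadicKummer.saturationConjugationInvariant_holds (ctx₂ B'') N g₂]
  exact ι.isNHSaturated_iff N

/-- **T44-L15b `Thm44Hyp.PreservesNHSaturatedBsFld` AT THE FAITHFUL [FrdII] Def 2.2 (ii) READING ⇐ the context
isomorphisms induced by `Ψ` UP TO INNER AUTOMORPHISM** (p.95 ll.14–16; [FrdII] Def 2.2 (i) «outer homomorphism»,
Def 2.2 (ii) «unaffected by conjugation», Thm 2.4 (i)): as `preservesNHSaturatedBsFld_of_def22Iso`, but the INPUT
`hIsoConj` only asks, for every Frobenius-trivial `A''` and every `B'' ≅ Ψ(A'')`, for an isomorphism of the Def 2.2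
contexts after re-choosing the representatives of the two outer homomorphisms `G_{K_i} ↠ G_{A_i}` (`conjOuter g_i`,
SOME `g₁`, `g₂`) — which is all that [FrdI] Thm 3.4 (v) / [SemiAnbd] Prop 3.2 / [AbsAnab] Lem 1.3.8 supply.
[cite: MochizukiEtTh2009, Thm 4.4 (iii) p.95] -/
theorem Thm44Hyp.preservesNHSaturatedBsFld_of_def22Iso_conjOuter (h : Thm44Hyp S₁ S₂)
    (ctx₁ : S₁.C → PadicKummer.Def22Context) (ctx₂ : S₂.C → PadicKummer.Def22Context)
    (hNH₁ : ∀ (A : S₁.C) (N : ℕ+),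
      S₁.IsNHSaturatedBsFld S₁.HodotBsFld A N ↔ PadicKummer.IsNHSaturated (ctx₁ A) N)
    (hNH₂ : ∀ (B : S₂.C) (N : ℕ+),
      S₂.IsNHSaturatedBsFld S₂.HodotBsFld B N ↔ PadicKummer.IsNHSaturated (ctx₂ B) N)
    (hIsoConj : ∀ (A'' : S₁.C) (B'' : S₂.C), S₁.IsFrobeniusTrivial A'' → (h.Ψ.functor.obj A'' ≅ B'') →
      ∃ (g₁ : (ctx₁ A'').G) (g₂ : (ctx₂ B'').G),
        Nonempty (PadicKummer.Def22Context.Iso ((ctx₁ A'').conjOuter g₁) ((ctx₂ B'').conjOuter g₂))) :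
    h.PreservesNHSaturatedBsFld := by
  intro A'' B'' N hft hisom
  obtain ⟨e⟩ := hisom
  obtain ⟨g₁, g₂, ⟨ι⟩⟩ := hIsoConj A'' B'' hft e
  exact isNHSaturatedBsFld_iff_of_def22Iso_conjOuter ctx₁ ctx₂ hNH₁ hNH₂ g₁ g₂ ι N

/-- **The plain form is the case `g₁ = g₂ = 1` up to the identity re-choice**: an honest context isomorphism gives one
up to inner automorphism (conjugating by `outer 1 = 1` changes nothing) — recorded as the implication between the two
INPUT shapes, so that users of either form meet. [cite: MochizukiFrdII2008, Def 2.2 (i) p.17] -/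
theorem def22IsoConj_of_def22Iso {X₁' X₂' : PadicKummer.Def22Context} (ι : PadicKummer.Def22Context.Iso X₁' X₂') :
    ∃ (g₁ : X₁'.G) (g₂ : X₂'.G), Nonempty (PadicKummer.Def22Context.Iso (X₁'.conjOuter g₁) (X₂'.conjOuter g₂)) := by
  refine ⟨1, 1, ⟨?_⟩⟩
  have h₁ : X₁'.conjOuter 1 = X₁' := by
    cases X₁'; simp only [PadicKummer.Def22Context.conjOuter, map_one]; rfl
  have h₂ : X₂'.conjOuter 1 = X₂' := by
    cases X₂'; simp only [PadicKummer.Def22Context.conjOuter, map_one]; rfl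
  rw [h₁, h₂]
  exact ι

end GeneralConj

end BiKummerSetting

end Literature.AnabelianGeometry.EtaleTheta

/-! ## v2 (append-only): `conjOuter 1` is the identity re-choice -/

namespace Literature.AlgebraicGeometry.Frobenioids.PadicKummer.Def22Context

/-- **Re-choosing the representative of the outer homomorphism by `outer 1 = 1` changes nothing: `X.conjOuter 1 = X`**
(so an honest context isomorphism `X₁ ⥲ X₂` is one «up to inner automorphism» with `g₁ = g₂ = 1`, and a one-sided
re-choice `X₁ ⥲ X₂.conjOuter g₂` is the case `g₁ = 1`). [cite: MochizukiFrdII2008, Def 2.2 (i) p.17] -/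
theorem conjOuter_one (X : Def22Context) : X.conjOuter 1 = X := by
  cases X; simp only [Def22Context.conjOuter, map_one]; rfl

end Literature.AlgebraicGeometry.Frobenioids.PadicKummer.Def22Context
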